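import Mathlib.RingTheory.PowerSeries.Binomial
import Mathlib.RingTheory.PowerSeries.Substitution
import Mathlib.NumberTheory.Padics.MahlerBasis
import Literature.NumberTheory.EllipticCurves.IwasawaCharacterPsi
import Literature.NumberTheory.EllipticCurves.KatoRankBoundProofs
import HarnessLib

/-!
# Change of topological generator in the Iwasawa algebra `Λ = ℤ_p⟦T⟧`: the substitution
# `T ↦ (1+T)^c − 1` (`c ∈ ℤ_pˣ`) as a ring automorphism fixing the augmentation prime `(T)`, and
# the congruences `(1+T)^x ≡ (1+T)^m (mod ω_n)` for `p`-adic exponents (Washington §13.2; proofs)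

Topic `NumberTheory/EllipticCurves` (namespace = path, grouping sub-namespace `GeneratorChange`).
Seat `bsd-input-kato-primet-lead` (literature-prover, LEAD), brick F2 of the port of Kato 2004
Conj. 12.10 at `(T)` (input `Kato2004.kato_mainConjecture_primeT_of_door`): the pure `Λ`-algebra
behind «lengths at `(T)` do not depend on the topological generator». ONE definition with a body
(`GeneratorChange.substEquiv c : Λ ≃+* Λ`, plumbing) and proved lemmas; no named fact, no `instance`,
no notation, no `sorry`. Nothing about elliptic curves or BSD is claimed here.

## The mathematics (all classical; Washington, *Introduction to Cyclotomic Fields*, §13.2, Thm. 7.1)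

`Λ = ℤ_p⟦T⟧ ≅ ℤ_p⟦Γ⟧` by `1 + T ↦ γ` for a topological generator `γ` of `Γ ≅ ℤ_p`; another
generator is `γ' = γ^c` with `c ∈ ℤ_pˣ`, and the two identifications differ by the CONTINUOUS RING
AUTOMORPHISM `φ_c : T ↦ (1+T)^c − 1 = cT + …` of `Λ`, where `(1+T)^c = ∑ₖ (c choose k) T^k` is the
binomial series (`PowerSeries.binomialSeries`; the tree's `IwasawaCharacter.onePlusTPow`). This file
proves, in the kernel:

* `binomialSeries_natCast_mul_eq_subst`, **`binomialSeries_mul_eq_subst`**: `(1+T)^{xy} = ((1+T)^x)^y`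
  for `p`-adic `x, y` — i.e. `binomialSeries (x*y) = (binomialSeries y).subst (binomialSeries x − 1)`
  (coefficientwise continuity in the exponent, Mahler's `PadicInt.continuous_choose`, and density of
  `ℕ` in `ℤ_p`; the `x ∈ ℕ` case is re-homed from the private lemma of
  `Literature/Barriers/BirchSwinnertonDyer/PAdicFunctionalEquationSharpFlatTwoProofs.lean`);
* **`exists_binomialSeries_pow_mul_sub_one_eq`, `exists_binomialSeries_sub_pow_eq`**:
  `(1+T)^{pⁿy} ≡ 1` and `(1+T)^x ≡ (1+T)^m (mod ω_n)`, `ω_n = (1+T)^{pⁿ} − 1`, when `x ≡ m (mod pⁿ)`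
  (re-homed from the same file, now public: they are the key to «`(1+T)^{κσ}` acts as `σ` on the
  `n`-th layer» for the tree's pinned Iwasawa modules);
* `GeneratorChange.subst c` (`= PowerSeries.subst ((1+T)^c − 1)`): a `ℤ_p`-algebra endomorphism of
  `Λ` with `subst c X = (1+T)^c − 1`, `subst c (C a) = C a`, `subst c ((1+T)^y) = (1+T)^{cy}`,
  `constantCoeff (subst c f) = constantCoeff f`, `subst c (subst d f) = subst (c*d) f`, `subst 1 = id`;
  hence for a unit `c` the RING AUTOMORPHISM **`GeneratorChange.substEquiv c : Λ ≃+* Λ`** (inverse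
  `subst c⁻¹`), which maps the augmentation prime `(T)` to itself
  (`comapEquiv_substEquiv_primeT`: as a point of `PrimeSpectrum Λ`, for use with the tree's
  `lengthAt_eq_of_semilinearEquiv`).

## References

* L. C. Washington, *Introduction to Cyclotomic Fields*, GTM 83 (2nd ed. 1997), Thm. 7.1 and §13.2
  (`ℤ_p⟦Γ⟧ ≅ ℤ_p⟦T⟧`, `γ ↦ 1 + T`; automorphisms of `Λ`). [Washington1997]
* J. Neukirch, A. Schmidt, K. Wingberg, *Cohomology of Number Fields* (2008), (5.3.5). [NeukirchSchmidtWingberg2008]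
* K. Mahler, *An interpolation series for continuous functions of a p-adic variable*, J. reine angew.
  Math. 199 (1958) — continuity of `x ↦ (x choose k)` on `ℤ_p` (Mathlib `PadicInt.continuous_choose`). [folklore]
* Tree: `IwasawaCharacterPsi.lean` (`onePlusTPow`, `Psi`), `KatoRankBoundProofs.lean`
  (`IwasawaAlgebra.primeT`), `Barriers/BirchSwinnertonDyer/PAdicFunctionalEquationSharpFlatTwoProofs.lean`
  §1 (the private originals of the congruences).
-/

noncomputable section

open PowerSeries Filter Topology
open Literature.NumberTheory.EllipticCurves Literature.NumberTheory.EllipticCurves.IwasawaAlgebra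

namespace Literature.NumberTheory.EllipticCurves

variable {p : ℕ} [Fact p.Prime]

/-! ## §1 Binomial series with `p`-adic exponents: substitution and congruences modulo `ω_n` -/

section Binomial

/-- `d ≤ ord (gᵈ)` when `g(0) = 0` (private helper). [folklore] -/
private theorem natCast_le_order_pow' {R : Type*} [CommRing R] {g : R⟦X⟧}
    (hg : constantCoeff g = 0) (d : ℕ) : (d : ℕ∞) ≤ (g ^ d).order := by
  have h1 : (1 : ℕ∞) ≤ g.order := (one_le_order_iff_constCoeff_eq_zero).mpr hg
  calc (d : ℕ∞) = d • (1 : ℕ∞) := by simp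
    _ ≤ d • g.order := nsmul_le_nsmul_right h1 d
    _ ≤ (g ^ d).order := le_order_pow g d

/-- The coefficient of `T^e` in a substitution `G(ω)` with `ω(0) = 0` is a FINITE sum:
`[T^e] G(ω) = Σ_{d ≤ e} [T^d]G · [T^e]ω^d` (private copy of the tree's
`coeff_subst_eq_sum_range` of `PAdicLFunctionFunctionalEquationProofs`, factors in this order). [folklore] -/
private theorem coeff_subst_eq_sum_range' {R : Type*} [CommRing R] {ω : R⟦X⟧} (hω : constantCoeff ω = 0)
    (G : R⟦X⟧) (e : ℕ) :
    coeff e (G.subst ω) = ∑ d ∈ Finset.range (e + 1), coeff d G * coeff e (ω ^ d) := by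
  rw [coeff_subst' (HasSubst.of_constantCoeff_zero' hω),
    finsum_eq_sum_of_support_subset _ (s := Finset.range (e + 1)) ?_]
  · simp only [smul_eq_mul]
  · intro d hd
    simp only [Function.mem_support, ne_eq, Finset.coe_range, Set.mem_Iio] at hd ⊢
    by_contra hlt
    apply hd
    rw [coeff_of_lt_order e (lt_of_lt_of_le (by exact_mod_cast (by omega : e < d))
      (natCast_le_order_pow' hω d)), smul_zero]

/-- **`(1+T)^{k·y} = ((1+T)^k)^y`** for a `p`-adic exponent `y ∈ ℤ_p` and `k ∈ ℕ`: both sides have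
coefficients continuous in `y` (Mahler) and agree for `y ∈ ℕ` (dense). Re-homed from the private
lemma of `Barriers/BirchSwinnertonDyer/PAdicFunctionalEquationSharpFlatTwoProofs.lean`.
[cite: Washington1997, §13.2] -/
theorem binomialSeries_natCast_mul_eq_subst (k : ℕ) (y : ℤ_[p]) :
    PowerSeries.binomialSeries ℤ_[p] ((k : ℤ_[p]) * y) =
      (PowerSeries.binomialSeries ℤ_[p] y).subst ((1 + X : ℤ_[p]⟦X⟧) ^ k - 1) := by
  set ω : ℤ_[p]⟦X⟧ := (1 + X) ^ k - 1 with hωdef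
  have hω : constantCoeff ω = 0 := by simp [hωdef]
  have hωs : HasSubst ω := HasSubst.of_constantCoeff_zero' hω
  ext e
  suffices h : (fun z : ℤ_[p] ↦ coeff e (PowerSeries.binomialSeries ℤ_[p] ((k : ℤ_[p]) * z))) =
      fun z ↦ coeff e ((PowerSeries.binomialSeries ℤ_[p] z).subst ω) from congrFun h y
  apply Continuous.ext_on PadicInt.denseRange_natCast
  · simp only [binomialSeries_coeff, smul_eq_mul, mul_one]
    exact (PadicInt.continuous_choose e).comp (continuous_const.mul continuous_id)
  · have hform : (fun z : ℤ_[p] ↦ coeff e ((PowerSeries.binomialSeries ℤ_[p] z).subst ω)) =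
        fun z ↦ ∑ d ∈ Finset.range (e + 1), Ring.choose z d * coeff e (ω ^ d) := by
      funext z
      rw [coeff_subst_eq_sum_range' hω]
      simp only [binomialSeries_coeff, smul_eq_mul, mul_one]
    rw [hform]
    exact continuous_finsetSum _ fun d _ ↦ (PadicInt.continuous_choose d).mul continuous_const
  · rintro _ ⟨m, rfl⟩
    have h1 : ((k : ℤ_[p]) * (m : ℤ_[p])) = ((k * m : ℕ) : ℤ_[p]) := by push_cast; ring
    have hone : (1 : ℤ_[p]⟦X⟧).subst ω = 1 := by
      rw [← coe_substAlgHom hωs, map_one]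
    simp only
    rw [h1, binomialSeries_nat, binomialSeries_nat, subst_pow hωs, subst_add hωs, hone,
      subst_X hωs, pow_mul, hωdef, add_sub_cancel]

/-- The coefficients of the binomial series are continuous in the `p`-adic exponent (Mahler;
private helper). [folklore] -/
private theorem continuous_coeff_binomialSeries (e : ℕ) :
    Continuous fun x : ℤ_[p] ↦ coeff e (PowerSeries.binomialSeries ℤ_[p] x) := by
  simp only [binomialSeries_coeff, smul_eq_mul, mul_one]
  exact PadicInt.continuous_choose e

/-- The coefficients of a fixed power of `(1+T)^x − 1` are continuous in the `p`-adic exponent `x`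
(finite sums of products of binomial coefficients; private helper). [folklore] -/
private theorem continuous_coeff_binomialSeries_sub_one_pow (d e : ℕ) :
    Continuous fun x : ℤ_[p] ↦ coeff e ((PowerSeries.binomialSeries ℤ_[p] x - 1) ^ d) := by
  induction d generalizing e with
  | zero =>
    simp only [pow_zero, coeff_one]
    exact continuous_const
  | succ d ih =>
    have hform : (fun x : ℤ_[p] ↦ coeff e ((PowerSeries.binomialSeries ℤ_[p] x - 1) ^ (d + 1))) =
        fun x ↦ ∑ ij ∈ Finset.antidiagonal e,
          coeff ij.1 ((PowerSeries.binomialSeries ℤ_[p] x - 1) ^ d) * coeff ij.2 (PowerSeries.binomialSeries ℤ_[p] x - 1) := by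
      funext x
      rw [pow_succ, coeff_mul]
    rw [hform]
    refine continuous_finsetSum _ fun ij _ ↦ (ih ij.1).mul ?_
    simp only [map_sub, coeff_one]
    exact (continuous_coeff_binomialSeries ij.2).sub continuous_const

/-- **`(1+T)^{x·y} = ((1+T)^x)^y` for `p`-adic exponents `x, y ∈ ℤ_p`**:
`binomialSeries (x * y) = (binomialSeries y).subst (binomialSeries x − 1)` — the substitution
`T ↦ (1+T)^x − 1` sends `(1+T)^y` to `(1+T)^{xy}` (continuity in `x` of both sides, density of `ℕ`,
and the case `x ∈ ℕ`). [cite: Washington1997, §13.2] -/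
theorem binomialSeries_mul_eq_subst (x y : ℤ_[p]) :
    PowerSeries.binomialSeries ℤ_[p] (x * y) =
      (PowerSeries.binomialSeries ℤ_[p] y).subst (PowerSeries.binomialSeries ℤ_[p] x - 1) := by
  ext e
  suffices h : (fun z : ℤ_[p] ↦ coeff e (PowerSeries.binomialSeries ℤ_[p] (z * y))) =
      fun z ↦ coeff e ((PowerSeries.binomialSeries ℤ_[p] y).subst (PowerSeries.binomialSeries ℤ_[p] z - 1)) from
    congrFun h x
  apply Continuous.ext_on PadicInt.denseRange_natCast
  · exact (continuous_coeff_binomialSeries e).comp (continuous_id.mul continuous_const)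
  · have hform : (fun z : ℤ_[p] ↦
          coeff e ((PowerSeries.binomialSeries ℤ_[p] y).subst (PowerSeries.binomialSeries ℤ_[p] z - 1))) =
        fun z ↦ ∑ d ∈ Finset.range (e + 1),
          coeff d (PowerSeries.binomialSeries ℤ_[p] y) * coeff e ((PowerSeries.binomialSeries ℤ_[p] z - 1) ^ d) := by
      funext z
      have hω : constantCoeff (PowerSeries.binomialSeries ℤ_[p] z - 1) = 0 := by
        rw [map_sub, binomialSeries_constantCoeff, map_one, sub_self]
      rw [coeff_subst_eq_sum_range' hω]
    rw [hform]
    exact continuous_finsetSum _ fun d _ ↦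
      continuous_const.mul (continuous_coeff_binomialSeries_sub_one_pow d e)
  · rintro _ ⟨k, rfl⟩
    simp only
    rw [binomialSeries_natCast_mul_eq_subst k y, binomialSeries_nat]

/-- **`(1+T)^{pⁿy} ≡ 1 (mod ω_n)`** in `Λ = ℤ_p⟦T⟧` for every `p`-adic exponent `y`, with
`ω_n = (1+T)^{pⁿ} − 1`: `(1+T)^{pⁿ y} − 1 = G(ω_n) − 1` for `G = (1+T)^y = 1 + T·H`. Re-homed (public)
from `Barriers/BirchSwinnertonDyer/PAdicFunctionalEquationSharpFlatTwoProofs.lean`.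
[cite: Washington1997, §13.2] -/
theorem exists_binomialSeries_pow_mul_sub_one_eq (n : ℕ) (y : ℤ_[p]) :
    ∃ q : ℤ_[p]⟦X⟧, PowerSeries.binomialSeries ℤ_[p] (((p ^ n : ℕ) : ℤ_[p]) * y) - 1 =
      ((1 + X : ℤ_[p]⟦X⟧) ^ (p ^ n) - 1) * q := by
  set ω : ℤ_[p]⟦X⟧ := (1 + X) ^ (p ^ n) - 1 with hωdef
  have hω : constantCoeff ω = 0 := by simp [hωdef]
  have hωs : HasSubst ω := HasSubst.of_constantCoeff_zero' hω
  set G : ℤ_[p]⟦X⟧ := PowerSeries.binomialSeries ℤ_[p] y with hG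
  have hG1 : constantCoeff G = 1 := binomialSeries_constantCoeff y
  obtain ⟨H, hH⟩ : ∃ H : ℤ_[p]⟦X⟧, G - 1 = X * H := by
    refine ⟨PowerSeries.mk fun i ↦ coeff (i + 1) (G - 1), ?_⟩
    ext i
    rcases i with _ | i
    · simp [coeff_zero_eq_constantCoeff_apply, hG1]
    · rw [coeff_succ_X_mul, coeff_mk]
  refine ⟨H.subst ω, ?_⟩
  rw [binomialSeries_natCast_mul_eq_subst, ← hωdef, ← hG]
  have hGe : G = 1 + X * H := by rw [← hH]; ring
  have hone : (1 : ℤ_[p]⟦X⟧).subst ω = 1 := by rw [← coe_substAlgHom hωs, map_one]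
  conv_lhs => rw [hGe, subst_add hωs, hone, subst_mul hωs, subst_X hωs]
  ring

/-- **`(1+T)^x ≡ (1+T)^m (mod ω_n)`** in `Λ` whenever the `p`-adic exponent `x` is congruent to the
natural number `m` modulo `pⁿ` (`toZModPow n x = m`). Re-homed (public) from
`Barriers/BirchSwinnertonDyer/PAdicFunctionalEquationSharpFlatTwoProofs.lean`.
[cite: Washington1997, §13.2] -/
theorem exists_binomialSeries_sub_pow_eq {n : ℕ} {x : ℤ_[p]} {m : ℕ}
    (hx : PadicInt.toZModPow n x = (m : ZMod (p ^ n))) :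
    ∃ q : ℤ_[p]⟦X⟧, PowerSeries.binomialSeries ℤ_[p] x - (1 + X : ℤ_[p]⟦X⟧) ^ m =
      ((1 + X : ℤ_[p]⟦X⟧) ^ (p ^ n) - 1) * q := by
  have hker : x - (m : ℤ_[p]) ∈ RingHom.ker (PadicInt.toZModPow (p := p) n) := by
    rw [RingHom.mem_ker, map_sub, map_natCast, hx, sub_self]
  rw [PadicInt.ker_toZModPow, Ideal.mem_span_singleton] at hker
  obtain ⟨y, hy⟩ := hker
  obtain ⟨q, hq⟩ := exists_binomialSeries_pow_mul_sub_one_eq n y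
  refine ⟨(1 + X : ℤ_[p]⟦X⟧) ^ m * q, ?_⟩
  have hx' : x = (m : ℤ_[p]) + ((p ^ n : ℕ) : ℤ_[p]) * y := by
    push_cast; linear_combination hy
  rw [hx', binomialSeries_add, binomialSeries_nat]
  linear_combination ((1 + X : ℤ_[p]⟦X⟧) ^ m) * hq

/-- For every `x ∈ ℤ_p` and `n` there is a natural number `m ≡ x (mod pⁿ)` (a lift of
`toZModPow n x`), with the congruence `(1+T)^x ≡ (1+T)^m (mod ω_n)`. [cite: Washington1997, §13.2] -/
theorem exists_nat_binomialSeries_sub_pow_mem_span (n : ℕ) (x : ℤ_[p]) :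
    ∃ m : ℕ, PadicInt.toZModPow n x = (m : ZMod (p ^ n)) ∧
      PowerSeries.binomialSeries ℤ_[p] x - (1 + X : ℤ_[p]⟦X⟧) ^ m ∈
        Ideal.span {((1 + X : ℤ_[p]⟦X⟧) ^ (p ^ n) - 1)} := by
  refine ⟨(PadicInt.toZModPow n x).val, ?_, ?_⟩
  · haveI : NeZero (p ^ n) := ⟨pow_ne_zero n (Fact.out : p.Prime).ne_zero⟩
    exact (ZMod.natCast_zmod_val _).symm
  · haveI : NeZero (p ^ n) := ⟨pow_ne_zero n (Fact.out : p.Prime).ne_zero⟩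
    obtain ⟨q, hq⟩ := exists_binomialSeries_sub_pow_eq (n := n) (x := x)
      (m := (PadicInt.toZModPow n x).val) (ZMod.natCast_zmod_val _).symm
    exact Ideal.mem_span_singleton'.mpr ⟨q, by rw [mul_comm, hq]⟩

end Binomial

/-! ## §2 The substitution `T ↦ (1+T)^c − 1` as an endomorphism / automorphism of `Λ` -/

namespace GeneratorChange

/-- `(1+T)^c − 1` has zero constant term. [cite: Washington1997, §13.2] -/
theorem constantCoeff_binomialSeries_sub_one (c : ℤ_[p]) :
    constantCoeff (PowerSeries.binomialSeries ℤ_[p] c - 1) = 0 := by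
  rw [map_sub, binomialSeries_constantCoeff, map_one, sub_self]

/-- `(1+T)^c − 1` is substitutable. [cite: Washington1997, §13.2] -/
theorem hasSubst (c : ℤ_[p]) : HasSubst (PowerSeries.binomialSeries ℤ_[p] c - 1) :=
  HasSubst.of_constantCoeff_zero' (constantCoeff_binomialSeries_sub_one c)

/-- **The change-of-generator endomorphism `φ_c : Λ → Λ`, `f ↦ f((1+T)^c − 1)`** (`c ∈ ℤ_p`), as a
`ℤ_p`-algebra homomorphism of `Λ = IwasawaAlgebra p = ℤ_p⟦T⟧` (Mathlib `PowerSeries.substAlgHom`).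
Under `1 + T ↦ γ` it is the map induced by `γ ↦ γ^c`. Plumbing definition.
[cite: Washington1997, §13.2] -/
def subst (c : ℤ_[p]) : IwasawaAlgebra p →ₐ[ℤ_[p]] IwasawaAlgebra p :=
  substAlgHom (hasSubst c)

/-- Unfolding: `subst c f = f.subst ((1+T)^c − 1)`. [cite: Washington1997, §13.2] -/
theorem subst_apply (c : ℤ_[p]) (f : IwasawaAlgebra p) :
    subst c f = PowerSeries.subst (PowerSeries.binomialSeries ℤ_[p] c - 1) f := by
  rw [subst, coe_substAlgHom]

/-- `φ_c(T) = (1+T)^c − 1`. [cite: Washington1997, §13.2] -/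
theorem subst_X (c : ℤ_[p]) :
    subst c (PowerSeries.X : IwasawaAlgebra p) = PowerSeries.binomialSeries ℤ_[p] c - 1 := by
  rw [subst_apply, PowerSeries.subst_X (hasSubst c)]

/-- `φ_c(1 + T) = (1+T)^c`. [cite: Washington1997, §13.2] -/
theorem subst_one_add_X (c : ℤ_[p]) :
    subst c (1 + PowerSeries.X : IwasawaAlgebra p) = PowerSeries.binomialSeries ℤ_[p] c := by
  rw [map_add, map_one, subst_X, add_sub_cancel]

/-- `φ_c` fixes constants: `φ_c(C a) = C a`. [cite: Washington1997, §13.2] -/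
theorem subst_C (c a : ℤ_[p]) : subst c (PowerSeries.C a : IwasawaAlgebra p) = PowerSeries.C a := by
  rw [subst_apply, PowerSeries.subst_C]
  rfl

/-- `φ_c` preserves the augmentation: `(φ_c f)(0) = f(0)`. [cite: Washington1997, §13.2] -/
theorem constantCoeff_subst (c : ℤ_[p]) (f : IwasawaAlgebra p) :
    constantCoeff (subst c f) = constantCoeff f := by
  rw [subst_apply, ← coeff_zero_eq_constantCoeff_apply,
    coeff_subst_eq_sum_range' (constantCoeff_binomialSeries_sub_one c), Finset.sum_range_one, pow_zero,
    coeff_zero_one, mul_one, coeff_zero_eq_constantCoeff_apply]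

/-- **`φ_c((1+T)^y) = (1+T)^{cy}`** (`γ^y ↦ γ^{cy}`). [cite: Washington1997, §13.2] -/
theorem subst_binomialSeries (c y : ℤ_[p]) :
    subst c (PowerSeries.binomialSeries ℤ_[p] y) = PowerSeries.binomialSeries ℤ_[p] (c * y) := by
  rw [subst_apply, ← binomialSeries_mul_eq_subst]

/-- `φ_c` on the tree's `onePlusTPow`: `φ_c((1+T)^y) = (1+T)^{cy}`. [cite: Washington1997, §13.2] -/
theorem subst_onePlusTPow (c y : ℤ_[p]) :
    subst c (IwasawaCharacter.onePlusTPow p ℤ_[p] y : IwasawaAlgebra p) =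
      (IwasawaCharacter.onePlusTPow p ℤ_[p] (c * y) : IwasawaAlgebra p) := by
  rw [IwasawaCharacter.val_onePlusTPow, IwasawaCharacter.val_onePlusTPow, subst_binomialSeries]

/-- **Composition: `φ_c ∘ φ_d = φ_{cd}`** (`(1+((1+T)^c−1))^d − 1 = (1+T)^{cd} − 1`).
[cite: Washington1997, §13.2] -/
theorem subst_subst (c d : ℤ_[p]) (f : IwasawaAlgebra p) :
    subst c (subst d f) = subst (c * d) f := by
  rw [subst_apply, subst_apply, subst_apply,
    PowerSeries.subst_comp_subst_apply (hasSubst d) (hasSubst c)]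
  congr 1
  rw [PowerSeries.subst_sub (hasSubst c), ← binomialSeries_mul_eq_subst,
    ← coe_substAlgHom (hasSubst c), map_one]

/-- `φ_1 = id` (`(1+T)^1 − 1 = T`). [cite: Washington1997, §13.2] -/
theorem subst_one (f : IwasawaAlgebra p) : subst 1 f = f := by
  rw [subst_apply]
  have h : PowerSeries.binomialSeries ℤ_[p] (1 : ℤ_[p]) - 1 = (PowerSeries.X : ℤ_[p]⟦X⟧) := by
    rw [show (1 : ℤ_[p]) = ((1 : ℕ) : ℤ_[p]) by norm_num, binomialSeries_nat, pow_one,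
      add_sub_cancel_left]
  rw [h, PowerSeries.X_subst]

/-- **The change-of-generator AUTOMORPHISM `φ_c : Λ ≃+* Λ` for a unit `c ∈ ℤ_pˣ`**, with inverse
`φ_{c⁻¹}`. [cite: Washington1997, §13.2] [cite: NeukirchSchmidtWingberg2008, (5.3.5)] -/
def substEquiv (c : ℤ_[p]ˣ) : IwasawaAlgebra p ≃+* IwasawaAlgebra p where
  toFun := subst (c : ℤ_[p])
  invFun := subst ((c⁻¹ : ℤ_[p]ˣ) : ℤ_[p])
  left_inv f := show subst ((c⁻¹ : ℤ_[p]ˣ) : ℤ_[p]) (subst (c : ℤ_[p]) f) = f by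
    rw [subst_subst, Units.inv_mul, subst_one]
  right_inv f := show subst (c : ℤ_[p]) (subst ((c⁻¹ : ℤ_[p]ˣ) : ℤ_[p]) f) = f by
    rw [subst_subst, Units.mul_inv, subst_one]
  map_mul' f g := map_mul _ f g
  map_add' f g := map_add _ f g

/-- Unfolding `substEquiv`. [cite: Washington1997, §13.2] -/
@[simp] theorem substEquiv_apply (c : ℤ_[p]ˣ) (f : IwasawaAlgebra p) :
    substEquiv c f = subst (c : ℤ_[p]) f := rfl

/-- Unfolding the inverse of `substEquiv`. [cite: Washington1997, §13.2] -/
@[simp] theorem substEquiv_symm_apply (c : ℤ_[p]ˣ) (f : IwasawaAlgebra p) :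
    (substEquiv c).symm f = subst ((c⁻¹ : ℤ_[p]ˣ) : ℤ_[p]) f := rfl

/-- `f ∈ (T)` iff `f(0) = 0`. [cite: Washington1997, §13.2] -/
theorem mem_primeT_iff (f : IwasawaAlgebra p) :
    f ∈ (primeT p).asIdeal ↔ constantCoeff f = 0 := by
  rw [primeT_asIdeal, Ideal.mem_span_singleton, PowerSeries.X_dvd_iff]

/-- **`φ_c` fixes the augmentation prime `(T)`** as a point of `Spec Λ`: the prime paired with `(T)`
under `substEquiv c` (`PrimeSpectrum.comapEquiv`) is `(T)` itself, since `φ_{c^{±1}}` preserve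
constant coefficients. This is the form consumed by `lengthAt_eq_of_semilinearEquiv`.
[cite: Washington1997, §13.2] -/
theorem comapEquiv_substEquiv_primeT (c : ℤ_[p]ˣ) :
    PrimeSpectrum.comapEquiv (substEquiv c) (primeT p) = primeT p := by
  ext f
  rw [PrimeSpectrum.comapEquiv_apply, PrimeSpectrum.comap_asIdeal, Ideal.mem_comap,
    mem_primeT_iff, mem_primeT_iff]
  change constantCoeff ((substEquiv c).symm f) = 0 ↔ _
  rw [substEquiv_symm_apply, constantCoeff_subst]

end GeneratorChange

end Literature.NumberTheory.EllipticCurves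

end
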